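import Summits.Ventures.Crystal3D.Theorems.StickyWulffConstantCoaxialWallLawSeamSatCensusTwelveOneFreeFiveNodes
import Summits.Ventures.Crystal3D.Theorems.StickyWulffConstantCoaxialWallLawSeamSatCensusTwelveOneFreeFivePin
import HarnessLib

/-!
# One-free-pair kissing configurations: the node-degree STRUCTURE THEOREM (packaging of '…OneFreeDegree', '…OneFreeFiveNodes', '…OneFreeFivePin')
# (crux `CoaxialWallLaw`, stmt-Ventures-19481; lane F stubs `stub_satCensus12Narrow` / `stub_satCensus12Glide` ⇐ C1 = `KissingClassificationOneFree (5/2)`)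

HONEST FRAMING. Venture `Summits/Ventures/Crystal3D` (cell `crystal3d-full`); helper `--supports` stmt-Ventures-19481, no stub closed.  One citable statement for the designer
of a C1 certificate (a K25-type growth search with one exempt pair), assembling the three bricks of this seat:
* **`oneFree_degree_dichotomy`** — for a one-free-pair `5/2`-configuration `S`: EITHER every node has at most FOUR contacts (then the K25 axiom `cdeg_le` holds verbatim and only
  `dichot` is relaxed at one label pair), OR there are exempt points `a ≠ b` in `S`, governing the dichotomy, with `dist a b ^ 2 = 128/27` EXACTLY (`⟪a, b⟫ = 44/27`), every
  node has at most five contacts, and at most two nodes have five.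
WHAT THIS IS NOT: C1 is NOT proved; no `SatCensus` piece is closed; F-C1 not moved.
-/

noncomputable section

namespace Summit.Ventures.Crystal3D.Theorems

namespace TailResidue

open Summit.Ventures.Crystal3D Finset
open scoped InnerProductSpace

/-- **Node-degree dichotomy of one-free-pair `5/2`-configurations.**  Either all nodes have `≤ 4` contacts, or the exempt pair is a genuine pair of points of `S` pinned at
squared distance `128/27` (inner product `44/27`), all nodes have `≤ 5` contacts and at most two have `5`. [cite: Hales2012, Lemma 7 (method)] -/
theorem oneFree_degree_dichotomy {S : Set (EuclideanSpace ℝ (Fin 3))} (hS : IsGapKissingConfigOneFree (5 / 2) S) :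
    (∀ v ∈ S, {u ∈ S | dist u v = 2}.ncard ≤ 4) ∨
    (∃ a ∈ S, ∃ b ∈ S, a ≠ b ∧ dist a b ^ 2 = 128 / 27 ∧ ⟪a, b⟫_ℝ = 44 / 27 ∧
      (∀ x ∈ S, ∀ y ∈ S, x = y ∨ dist x y = 2 ∨ (5 / 2 : ℝ) ≤ dist x y ∨ (x = a ∧ y = b) ∨ (x = b ∧ y = a)) ∧
      (∀ v ∈ S, {u ∈ S | dist u v = 2}.ncard ≤ 5) ∧ {v ∈ S | 5 ≤ {u ∈ S | dist u v = 2}.ncard}.ncard ≤ 2) := by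
  classical
  by_cases h4 : ∀ v ∈ S, {u ∈ S | dist u v = 2}.ncard ≤ 4
  · exact Or.inl h4
  right
  push Not at h4
  obtain ⟨v, hv, hlt⟩ := h4
  have hfinS : S.Finite := hS.finite
  have h5nodes := ncard_fiveNodes_le_two_of_oneFree hS
  have hdeg5 : ∀ w ∈ S, {u ∈ S | dist u w = 2}.ncard ≤ 5 := fun w hw => ncard_contacts_le_five_of_oneFree hS hw
  obtain ⟨hcard, h12, hpk, a, b, hdich⟩ := hS
  -- the contact set of v as a finset with ≥ 5 elements
  have hf : {u ∈ S | dist u v = 2}.Finite := hfinS.subset fun u hu => hu.1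
  set F := hf.toFinset with hF
  have hFmem : ∀ u, u ∈ F ↔ u ∈ S ∧ dist u v = 2 := fun u => by rw [hF, Set.Finite.mem_toFinset]; rfl
  have h5 : 5 ≤ F.card := by
    have := Set.ncard_eq_toFinset_card _ hf
    rw [← hF] at this; omega
  obtain ⟨haF, hbF⟩ := card_contacts_le_four_of_oneFree h12 hdich hv (fun u hu => ((hFmem u).1 hu).1) (fun u hu => ((hFmem u).1 hu).2) h5
  have haS : a ∈ S := ((hFmem a).1 haF).1
  have hbS : b ∈ S := ((hFmem b).1 hbF).1
  have hsq : dist a b ^ 2 = 128 / 27 :=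
    dist_sq_exempt_eq_of_five_contacts h12 hpk hdich hv (fun u hu => ((hFmem u).1 hu).1) (fun u hu => ((hFmem u).1 hu).2) h5
  have hab : a ≠ b := by
    intro h
    rw [h, dist_self] at hsq
    norm_num at hsq
  have hinner : ⟪a, b⟫_ℝ = 44 / 27 := by
    have h1 : ‖a - b‖ ^ 2 = 128 / 27 := by rw [← dist_eq_norm]; exact hsq
    rw [norm_sub_sq_real, h12 a haS, h12 b hbS] at h1
    linarith
  exact ⟨a, haS, b, hbS, hab, hsq, hinner, hdich, hdeg5, h5nodes⟩

end TailResidue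

end Summit.Ventures.Crystal3D.Theorems

end
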